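import Literature.Geometry.DiscreteGeometry.ShellCensusReplayEscapeSound
import HarnessLib

/-!
# Census certificates with LP leaves: quadratic forms, RLT generators, the checker

Topic `Literature/Geometry/DiscreteGeometry`; replayer EXTENSION #3 for the certificate stubs
`stub_ffrC5NoOpenStar` / `stub_ffrC5NoFarFacet` of crux `FiveFoldRationingR`
(stmt-AtomisticToContinuum-18071). Part 1 of 3: exact rational quadratic forms over the box
variables, the generators of valid quadratic inequalities, the `lp` leaf test, the certificate
trees `LTree` (= `ETree` of `ShellCensusReplayEscape.lean` + the leaf `lp`), the checker, and a toy
census checked in the kernel; soundness in `ShellCensusReplayLPSound.lean` (part 2), the text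
decoder in `ShellCensusReplayLPText.lean` (part 3). Built on `ShellCensusReplay.lean` /
`ShellCensusReplayEscape.lean` (`Spec`, `Admissible`, `Sat`, `DegOK`, `FacetLE`, boxes, `Witness`,
`witnessOK`, `acceptOK`, `tornOK`, `cappedOK`, `facetOK`, `relabel`, `permOK`, `fixesB`), whose
tests are reused verbatim. Everything here is COMPUTABLE (structural recursion, `decide` on `ℚ`,
dense coefficient arrays; `decide +kernel` on toys, `native_decide` on the lane's certificates).

## Why a new leaf

The leaves `empty w` of the replayer refute a box by ONE constraint evaluated in interval
arithmetic. The feasible region of the open-star motif is a thin 18-dimensional set: single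
constraints separate boxes from it only at widths `≈ 0.005`, far too fine for a 33-variable box
search. The `lp` leaf refutes a box by a NONNEGATIVE COMBINATION OF ALL valid constraints at once
(linear-programming duality made into a certificate), which sees trilateration information and
ignores irrelevant coordinates.

## The mathematics of the `lp` leaf

Framed node: specification `P`, constraint list `S`, box `B`; variables `x = flat t : ℕ → ℝ`
(coordinate `i` of point `k` is `x_{3k+i}`), homogenised as `X₀ = 1`, `X_{a+1} = x_a`
(`hvar`). Each GENERATOR `g : Gen` names a polynomial `poly g` of degree `≤ 2` with rational
coefficients that is `≥ 0` at `x = flat t` for every admissible `t` with `Sat S t` in the box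
(`Gen.seval_poly_nonneg`, part 2), provided `g.valid`:

* `normLo k`: `‖t k‖² − rlo²`;  `normHi k`: `rhi² − ‖t k‖²`  (`k < n`);
* `core k l`: `dist (t k) (t l)² − dlo²`  (`k ≠ l`);
* `bond k l`: `dhi² − dist²` for `(k, l, true) ∈ S`;  `far k l`: `dist² − gap²` for `(k, l, false) ∈ S`;
* `bfLo a`: `x_a − lo_a`;  `bfHi a`: `hi_a − x_a`  (`[lo_a, hi_a] = B.ivl a`, `a < 3n`);
* `prod a sa b sb`: the product of two such bound factors (sides `sa`, `sb`; `false` = lower) —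
  the reformulation–linearisation (RLT) bound-factor products of Sherali–Adams, i.e. the
  McCormick inequalities of the bilinear terms `x_a x_b` on the box.

An `lp` CERTIFICATE for the box is `c : ℚ`, `c > 0`, and a list of pairs `(g, λ_g)` with
`λ_g ≥ 0` such that `c + Σ λ_g · poly g ≡ 0` IDENTICALLY (every coefficient of the quadratic
form in `X₀, …, X_{3n}` vanishes) — a linear Positivstellensatz certificate. At a feasible point
the left side would evaluate to `c + (≥ 0) > 0`; so the box contains no feasible point and the
framed claim holds vacuously (`Spec.efclaim_of_lp`, part 2). The identity is checked by EXACT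
rational arithmetic on a dense coefficient table `QF` of size `(3n+1)²` (`QF.addMono`,
`QF.addScaled`, `Spec.lpForm`, `QF.isZero`). Guidance for the lane: find the multipliers by the
dual LP over the generators, round them to nonnegative dyadics of modest precision (fast exact
arithmetic), and ABSORB the rounding residual `r = c' + Σ λ_g · poly g` exactly with bound-factor
generators: `ε x_a x_b = ε · prod a lo b lo + (linear)` (`ε > 0`), `−ε x_a x_b = ε · prod a lo b hi
+ (linear)`, `δ x_a = δ · bfLo a + δ lo_a` (`δ > 0`), `−δ x_a = δ · bfHi a − δ hi_a`, the constant
going into `c` (which must stay positive) — so an exact identity is always reachable.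

## Certificates and the checker

`LTree` = the constructors of `ETree` (`case`, `ref`, `torn`, `capped`, `frame`, `split`, `empty`,
`aboveFacet`, `accept`; same tests) + `lp c lams` (test `Spec.lpOK`, inside a frame only);
`LTree.check`, `LCensus`, `LCensus.checkFrom`, `LCensus.check` have the shape of their `E`
counterparts. Text tag `10` (part 3).

## References
* H. D. Sherali, W. P. Adams, SIAM J. Discrete Math. 3 (1990), §2 (bound-factor products, RLT).
  [cite: SheraliAdams1990, §2]
* R. E. Moore, *Interval Analysis* (1966), §4.4 (exclusion by subdivision). [cite: Moore1966, §4.4]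
-/

namespace Literature.Geometry.DiscreteGeometry

open Literature.Analysis.ValidatedNumerics NonemptyInterval Finset

/-- Euclidean `3`-space. -/
local notation "E3" => EuclideanSpace ℝ (Fin 3)

namespace ShellCensus

/-! ### Sparse and dense quadratic forms over the homogenised variables -/

/-- A monomial `c · X_i · X_j` of the homogenised variables, as the triple `(i, j, c)`. [folklore] -/
abbrev Mono : Type := ℕ × ℕ × ℚ

/-- The homogenised variables of a point `x : ℕ → ℝ`: `X₀ = 1`, `X_{a+1} = x_a`. [folklore] -/
noncomputable def hvar (x : ℕ → ℝ) : ℕ → ℝ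
  | 0 => 1
  | a + 1 => x a

/-- Value of a monomial at `x`. [folklore] -/
noncomputable def Mono.eval (x : ℕ → ℝ) (u : Mono) : ℝ := (u.2.2 : ℝ) * (hvar x u.1 * hvar x u.2.1)

/-- Value of a sparse polynomial (a list of monomials) at `x`. [folklore] -/
noncomputable def seval (x : ℕ → ℝ) (L : List Mono) : ℝ := (L.map (Mono.eval x)).sum

/-- All variable indices of a sparse polynomial are `≤ m` (so they fit the dense table). [folklore] -/
def monosLE (m : ℕ) (L : List Mono) : Bool :=
  L.all fun u => decide (u.1 ≤ m) && decide (u.2.1 ≤ m)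

/-- **Dense quadratic forms** over `X₀, …, X_m` with exact rational coefficients: the
coefficient of `X_i X_j`, `i ≤ j`, sits at index `i (m+1) + j` of an array of size `(m+1)²`
(the strict lower triangle stays zero). [folklore] -/
abbrev QF : Type := Array ℚ

namespace QF

/-- Index of the monomial `X_i X_j` in the dense table (symmetrised: `i, j` in either order). [folklore] -/
def idx (m i j : ℕ) : ℕ := min i j * (m + 1) + max i j

/-- The zero form. [folklore] -/
def zero (m : ℕ) : QF := Array.replicate ((m + 1) * (m + 1)) 0

/-- Add `c · X_i X_j` (exact; a no-op if the index is out of range, which `monosLE` excludes). [folklore] -/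
def addMono (m : ℕ) (q : QF) (i j : ℕ) (c : ℚ) : QF :=
  if h : idx m i j < q.size then q.set (idx m i j) (q[idx m i j] + c) else q

/-- Add `lam · L` for a sparse polynomial `L`. [folklore] -/
def addScaled (m : ℕ) (lam : ℚ) : QF → List Mono → QF
  | q, [] => q
  | q, (i, j, c) :: rest => addScaled m lam (q.addMono m i j (lam * c)) rest

/-- **The identity test**: every coefficient vanishes. [folklore] -/
def isZero (q : QF) : Bool := q.toList.all fun c => decide (c = 0)

/-- Value of a dense form at `x` (index `p` holds the coefficient of `X_{p / (m+1)} X_{p % (m+1)}`). [folklore] -/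
noncomputable def eval (m : ℕ) (q : QF) (x : ℕ → ℝ) : ℝ :=
  ∑ p ∈ range ((m + 1) * (m + 1)), ((q[p]?.getD 0 : ℚ) : ℝ) * (hvar x (p / (m + 1)) * hvar x (p % (m + 1)))

end QF

/-! ### Generators of valid quadratic inequalities -/

/-- **Generators**: names of quadratic polynomials nonnegative on the feasible set of a framed
node — norm window, hard core, decided bond / far windows, box bound factors and their pairwise
products (RLT). [cite: SheraliAdams1990, §2] -/
inductive Gen : Type
  /-- `‖t k‖² − rlo² ≥ 0` -/
  | normLo (k : ℕ)
  /-- `rhi² − ‖t k‖² ≥ 0` -/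
  | normHi (k : ℕ)
  /-- `dist (t k) (t l)² − dlo² ≥ 0` (`k ≠ l`) -/
  | core (k l : ℕ)
  /-- `dhi² − dist (t k) (t l)² ≥ 0` for a decided bond `(k, l, true) ∈ S` -/
  | bond (k l : ℕ)
  /-- `dist (t k) (t l)² − gap² ≥ 0` for a decided far pair `(k, l, false) ∈ S` -/
  | far (k l : ℕ)
  /-- lower bound factor `x_a − lo_a ≥ 0` -/
  | bfLo (a : ℕ)
  /-- upper bound factor `hi_a − x_a ≥ 0` -/
  | bfHi (a : ℕ)
  /-- product of the bound factors of `x_a` (side `sa`) and `x_b` (side `sb`); `false` = lower -/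
  | prod (a : ℕ) (sa : Bool) (b : ℕ) (sb : Bool)
  deriving DecidableEq, Repr, Inhabited

/-- Homogenised index of coordinate `i` of point `k`: `x_{3k+i} = X_{3k+i+1}`. [folklore] -/
def hv (k i : ℕ) : ℕ := 3 * k + i + 1

/-- `s · ‖t k‖²` as a sparse polynomial. [folklore] -/
def sqNormMonos (k : ℕ) (s : ℚ) : List Mono :=
  [(hv k 0, hv k 0, s), (hv k 1, hv k 1, s), (hv k 2, hv k 2, s)]

/-- `s · dist (t k) (t l)²` as a sparse polynomial. [folklore] -/
def sqDistMonos (k l : ℕ) (s : ℚ) : List Mono :=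
  [(hv k 0, hv k 0, s), (hv l 0, hv l 0, s), (hv k 0, hv l 0, -(2 * s)),
    (hv k 1, hv k 1, s), (hv l 1, hv l 1, s), (hv k 1, hv l 1, -(2 * s)),
    (hv k 2, hv k 2, s), (hv l 2, hv l 2, s), (hv k 2, hv l 2, -(2 * s))]

/-- The bound factor of coordinate `a` on side `side` as `(coefficient of x_a, constant)`:
lower `x_a − lo_a ↦ (1, −lo_a)`, upper `hi_a − x_a ↦ (−1, hi_a)`. [cite: SheraliAdams1990, §2] -/
def bfac (B : Box) (a : ℕ) (side : Bool) : ℚ × ℚ :=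
  if side then (-1, (B.ivl a).2) else (1, -(B.ivl a).1)

/-- The affine polynomial `α₁ x_a + α₀` as a sparse polynomial. [folklore] -/
def affMonos (a : ℕ) (f : ℚ × ℚ) : List Mono := [(0, a + 1, f.1), (0, 0, f.2)]

/-- **The polynomial of a generator** (sparse, homogenised indexing). [cite: SheraliAdams1990, §2] -/
def Gen.poly (P : Spec) (B : Box) : Gen → List Mono
  | .normLo k => sqNormMonos k 1 ++ [(0, 0, -(P.rlo ^ 2))]
  | .normHi k => sqNormMonos k (-1) ++ [(0, 0, P.rhi ^ 2)]
  | .core k l => sqDistMonos k l 1 ++ [(0, 0, -(P.dlo ^ 2))]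
  | .bond k l => sqDistMonos k l (-1) ++ [(0, 0, P.dhi ^ 2)]
  | .far k l => sqDistMonos k l 1 ++ [(0, 0, -(P.gap ^ 2))]
  | .bfLo a => affMonos a (bfac B a false)
  | .bfHi a => affMonos a (bfac B a true)
  | .prod a sa b sb =>
      [(a + 1, b + 1, (bfac B a sa).1 * (bfac B b sb).1), (0, a + 1, (bfac B a sa).1 * (bfac B b sb).2),
        (0, b + 1, (bfac B a sa).2 * (bfac B b sb).1), (0, 0, (bfac B a sa).2 * (bfac B b sb).2)]

/-- **Validity of a generator** at a node: index ranges, and for `bond` / `far` literal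
membership of the decided pair in `S` (as in `witnessOK`). [folklore] -/
def Gen.valid (P : Spec) (S : List Constraint) : Gen → Bool
  | .normLo k => decide (k < P.n)
  | .normHi k => decide (k < P.n)
  | .core k l => decide (k < P.n) && decide (l < P.n) && !(k == l)
  | .bond k l => decide (k < P.n) && decide (l < P.n) && decide ((k, l, true) ∈ S)
  | .far k l => decide (k < P.n) && decide (l < P.n) && decide ((k, l, false) ∈ S)
  | .bfLo a => decide (a < 3 * P.n)
  | .bfHi a => decide (a < 3 * P.n)
  | .prod a _ b _ => decide (a < 3 * P.n) && decide (b < 3 * P.n)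

/-! ### Evaluation helpers (used by the soundness proofs of part 2) -/

section Helpers

variable {n : ℕ} {t : Fin n → E3}

/-- Coordinate `0` of point `k` as a flattened variable. [folklore] -/
theorem flat_apply_zero {k : ℕ} (hk : k < n) : flat t (3 * k) = t ⟨k, hk⟩ 0 := by
  simpa using flat_apply t ⟨k, hk⟩ 0

/-- Coordinate `1` of point `k` as a flattened variable. [folklore] -/
theorem flat_apply_one {k : ℕ} (hk : k < n) : flat t (3 * k + 1) = t ⟨k, hk⟩ 1 := by
  simpa using flat_apply t ⟨k, hk⟩ 1

/-- Coordinate `2` of point `k` as a flattened variable. [folklore] -/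
theorem flat_apply_two {k : ℕ} (hk : k < n) : flat t (3 * k + 2) = t ⟨k, hk⟩ 2 := by
  simpa using flat_apply t ⟨k, hk⟩ 2

/-- Sparse evaluation is additive over concatenation. [folklore] -/
theorem seval_append (x : ℕ → ℝ) (L L' : List Mono) : seval x (L ++ L') = seval x L + seval x L' := by
  simp [seval]

/-- A constant monomial evaluates to the constant. [folklore] -/
theorem seval_const (x : ℕ → ℝ) (c : ℚ) : seval x [(0, 0, c)] = c := by
  simp [seval, Mono.eval, hvar]

end Helpers

/-! ### The `lp` leaf test -/

namespace Spec

variable (P : Spec)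

/-- Accumulate `Σ λ_g · poly g` onto a dense form (`3n` box variables). [folklore] -/
def addGens (B : Box) : QF → List (Gen × ℚ) → QF
  | q, [] => q
  | q, (g, lam) :: rest => addGens B (q.addScaled (3 * P.n) lam (g.poly P B)) rest

/-- The dense form `c + Σ λ_g · poly g` of an `lp` leaf. [folklore] -/
def lpForm (B : Box) (c : ℚ) (lams : List (Gen × ℚ)) : QF :=
  P.addGens B ((QF.zero (3 * P.n)).addMono (3 * P.n) 0 0 c) lams

/-- **The `lp` leaf test**: `c > 0`, every multiplier is `≥ 0`, every generator is valid with
its monomials in range, and `c + Σ λ_g · poly g` is identically zero. [cite: SheraliAdams1990, §2] -/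
def lpOK (S : List Constraint) (B : Box) (c : ℚ) (lams : List (Gen × ℚ)) : Bool :=
  decide (0 < c) &&
    (lams.all fun gl => decide (0 ≤ gl.2) && gl.1.valid P S && monosLE (3 * P.n) (gl.1.poly P B)) &&
    (P.lpForm B c lams).isZero

end Spec

/-! ### Certificates and the checker -/

/-- **Census certificate trees with LP leaves**: the trees of `ShellCensusReplayEscape.ETree`
with the leaf `lp`. [folklore] -/
inductive LTree : Type
  /-- case split on the pair `(k, l)` -/
  | case (k l : ℕ) (bond far : LTree)
  /-- back-reference to claim `j` of the context, relabelled -/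
  | ref (perm : List ℕ) (j : ℕ)
  /-- degree escape: `k` has too many decided far partners -/
  | torn (k : ℕ)
  /-- degree escape: `k` has too many decided bonds -/
  | capped (k : ℕ)
  /-- fix the frame -/
  | frame (sub : LTree)
  /-- bisect coordinate `axis` at `cut` -/
  | split (axis : ℕ) (cut : ℚ) (lo hi : LTree)
  /-- excluded box (one constraint, interval arithmetic) -/
  | empty (w : Witness)
  /-- the facet polynomial at label `l` is positive on the box (precision `prec`) -/
  | aboveFacet (l : ℕ) (prec : ℕ)
  /-- accepted box -/
  | accept (pat : ℕ) (mat : List ℚ) (perm : List ℕ)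
  /-- excluded box (LP certificate `c + Σ λ_g · poly g ≡ 0`) -/
  | lp (c : ℚ) (lams : List (Gen × ℚ))
  deriving Inhabited, DecidableEq

/-- **The certificate checker with LP leaves** (structural recursion; kernel-evaluable): as
`ETree.check`, plus the test `Spec.lpOK` on `lp` leaves inside a frame. [folklore] -/
def LTree.check (P : Spec) (dmin dmax : ℕ) (f : Option (ℕ × ℕ × ℕ)) (ctx : Array (List Constraint)) :
    List Constraint → Option Box → LTree → Bool
  | S, ob, .case k l tb tf => decide (k < P.n) && decide (l < P.n) && !(k == l) &&
      LTree.check P dmin dmax f ctx ((k, l, true) :: S) ob tb &&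
        LTree.check P dmin dmax f ctx ((k, l, false) :: S) ob tf
  | S, _, .ref π j =>
      match ctx[j]? with
      | none => false
      | some S₀ => permOK P.n π && fixesB f π && (relabel π S₀).all fun c => decide (c ∈ S)
  | S, _, .torn k => P.tornOK dmin S k
  | S, _, .capped k => P.cappedOK dmax S k
  | S, none, .frame sub => LTree.check P dmin dmax f ctx S (some P.rootBox) sub
  | _, some _, .frame _ => false
  | S, some B, .split axis cut lo hi =>
      LTree.check P dmin dmax f ctx S (some (B.split axis cut).1) lo &&
        LTree.check P dmin dmax f ctx S (some (B.split axis cut).2) hi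
  | _, none, .split _ _ _ _ => false
  | S, some B, .empty w => P.witnessOK S B w
  | _, none, .empty _ => false
  | _, some B, .aboveFacet l prec => P.facetOK f B l prec
  | _, none, .aboveFacet _ _ => false
  | _, some B, .accept pat M σ => P.acceptOK B pat M σ
  | _, none, .accept _ _ _ => false
  | S, some B, .lp c lams => P.lpOK S B c lams
  | _, none, .lp _ _ => false

/-- A **census certificate with LP leaves**: constraint lists with their trees, in dependency
order. [folklore] -/
abbrev LCensus : Type := List (List Constraint × LTree)

/-- Check the entries in order, each against the context of the earlier ones. [folklore] -/
def LCensus.checkFrom (P : Spec) (dmin dmax : ℕ) (f : Option (ℕ × ℕ × ℕ)) :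
    Array (List Constraint) → LCensus → Bool
  | _, [] => true
  | ctx, (S, tr) :: rest =>
      tr.check P dmin dmax f ctx S none && LCensus.checkFrom P dmin dmax f (ctx.push S) rest

/-- **The census checker with LP leaves**: the data are sound (`okB`), every entry checks, and
some entry has the target constraint list `S`. [folklore] -/
def LCensus.check (P : Spec) (dmin dmax : ℕ) (f : Option (ℕ × ℕ × ℕ)) (S : List Constraint)
    (C : LCensus) : Bool :=
  P.okB && LCensus.checkFrom P dmin dmax f #[] C && C.any fun e => decide (e.1 = S)

/-! ### A toy census, checked in the kernel -/

/-- A toy specification: three unit vectors, pairs within `1/10` or at least `3` apart, no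
anchors (an infeasibility census). [folklore] -/
def toyLSpec : Spec where
  n := 3
  rlo := 1
  rhi := 1
  dlo := 0
  dhi := 1 / 10
  gap := 3
  eta := 1
  eps := 0
  anchors := []

/-- An `lp` leaf refuting "pair `(0,1)` far" on the root box with coordinate `3` widened to
`[0, 2]` (`t 0 = (0,0,1)`, `t 1 = (x₃, 0, x₅)`, `x₃ ∈ [0,2]`, `x₅ ∈ [−1,1]`): the generator
`far 0 1` (`dist² − 9 ≥ 0`) plus RLT products bounding `dist² ≤ 8` on the box sum with `c = 1`
to the zero polynomial (multipliers found by hand). [folklore] -/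
def toyLp : LTree :=
  .lp 1 [(.far 0 1, 1), (.prod 0 false 0 true, 1), (.prod 3 false 3 true, 1), (.bfHi 3, 2),
    (.prod 0 false 3 false, 2), (.prod 1 false 1 true, 1), (.prod 4 false 4 true, 1),
    (.prod 1 false 4 false, 2), (.prod 2 false 2 true, 1), (.bfHi 2, 2), (.prod 5 false 5 true, 1),
    (.prod 2 false 5 false, 1), (.prod 2 true 5 true, 1), (.bfLo 5, 2)]

/-- A toy census for the degree window `[0, 0]` without facet condition: "pair `(0,1)` far" is
infeasible (entry 0: frame, a split whose upper part is void and whose lower part is closed by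
the `lp` leaf); the target entry 1 (`S = []`) splits on the pair: a bond is `capped`, far is a
reference to entry 0. [folklore] -/
def toyLCensus : LCensus :=
  [([(0, 1, false)], .frame (.split 3 2 toyLp (.empty (.void 3)))),
   ([], .case 0 1 (.capped 0) (.ref [0, 1, 2] 0))]

/-- The toy census is accepted (kernel evaluation of the checker). [folklore] -/
theorem toyLCensus_check : LCensus.check toyLSpec 0 0 none [] toyLCensus = true := by
  decide +kernel

end ShellCensus

end Literature.Geometry.DiscreteGeometry
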